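import Summits.Ventures.WeilGRH.UniformConductorFloorLog12TableHi
import HarnessLib

/-!
# GRH arm (rh-explicit, venture WeilGRH): the 256-mode special-value table at `a = (log 12)/2` — validity of the records of the modes `248 … 255`
  (kernel certificate, high part 7 of seven)

Cell `rh-explicit`, WEIL TRACK — GRH ARM (weil-grh-1, gen10).  `checkTable` slice `[248, 256)` of `Log12Table.tab256` (`UniformConductorFloorLog12TableHi.lean`:
modes `0 … 127` of the tree table `Log12Table.tab` followed by `tabPHi`): recompute `Encl.idxRec` at every mode, test containment (≈ 5 s per mode in the
kernel).  The seven high parts import only the data and file in parallel; they are glued — with the 128-mode validity `Log12Table.tab_valid` for the low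
modes — into `tab256_valid : TabValid (2^80) a ks 256 tab256` in `UniformConductorFloorLog12Table256Valid.lean`.  Purpose: the door-E cell for the last
open prime `281` of rung six needs far block `B₃ = 255`.  No definitions; no named facts; standard axioms. [cite: Moore1966, Ch. 3 (interval arithmetic: inclusion property)]
-/

set_option maxRecDepth 200000

namespace Summit.Ventures.WeilGRH.Log12Table
open Literature.NumberTheory.LFunctions Literature.NumberTheory.LFunctions.Yoshida1992 Encl Literature.Analysis.ValidatedNumerics.NumericsMP

/-- kernel: slice `[248, 256)` of the 256-mode table. [cite: Moore1966, Ch. 3 (interval arithmetic: inclusion property)] -/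
theorem tH248 : checkTable prm C tab256 248 8 = true := by decide +kernel

end Summit.Ventures.WeilGRH.Log12Table
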